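import Literature.MathematicalPhysics.QuantumFieldTheory.Balaban1983to89.Beta.AveragingContours

/-!
# `Balaban1983to89.Beta.AveragingContoursRooted` — node 5's block contours with a GENERIC ROOT OFFSET `ρ`
# (the centred rooting of [Balaban1987RG1] p.251 is `ρ = ((L−1)/2)·𝟙`, `L` odd), v1

HONEST FRAMING (page 1, mandatory).  This leaf belongs to the β sub-cell of the Bałaban audit, whose END STATEMENT is:
discharging the one-loop hypothesis `FlowStep.BetaPertH` makes Bałaban's ultraviolet stability theorem for 4-d lattice
Yang–Mills ([Balaban1989LargeFieldII], Thm. 1 p. 355) UNCONDITIONAL inside this package — a real constructive-QFT result;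
it is NOT the continuum limit and NOT the Clay problem.  EVERYTHING below is kernel-proved [folklore] combinatorics of
lists and finite sums on `ℤ^d`; NOTHING is cited as a fact.

ABSOLUTE RULE (cell charter, verbatim): «No internally-minted statement may enter as a cited fact. Every hypothesis is
either kernel-proved in this package or a verbatim quotation of a PUBLISHED theorem with page reference. The manuscript(s)
under audit are NOT citable for their own disputed steps — they are the thing under adjudication; programme-internal
(2001/route/tribunal) claims are never citable.»  Accordingly NO declaration below is a `def … : Prop` carrying a
citation and no hypothesis of any theorem is a printed statement: every declaration is [folklore]; the quotations are
object LOCATORS only.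

WHY THIS LEAF (β-lead RULING (R32), journal 2026-08-19 post-rotation l.304, accepting an5's finding X-an5-17).  Node 5
(`Beta.AveragingContours`) roots every block contour `Γ_{c,x}` at the BASE CORNER `L·y` of the block `B(y) = L·y +
{0,…,L−1}^d` — the literal transcription of [Balaban1984PropagatorsI] p.18 (1.6)/(1.7) («B(y) = {x ∈ T₁ : y_μ ≦ x_μ <
y_μ + L}», contours «with initial point y»).  The renormalization-group papers root them at the block CENTRE:
[Balaban1987RG1] (= B12, CMP 109) p.251 «We take L_μ = L^m, where L is an odd, positive integer > 11 … Each lattice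
determines a lattice of centers of these cubes … A point y ∈ T determines a cube of the continuous torus with a center at
y», p.252 (0.3) (contours from the centre).  an5's X-an5-17 (F0)–(F2) showed that NO base-rooted construction is carried
to itself by a block-compatible axis reflection, whereas the centre-rooted one (odd `L`) is; (R32-1) therefore re-roots
the road's literal family at `ρ_c = ((L−1)/2)·𝟙` and asks this lineage for «the root parameter ρ for node 5
`gammaC`/`loopC` and the counts/kernels above it — cheapest faithful form first».  THIS LEAF is that first stone: node
5's §3–§5 with the root `L·y` replaced by `L·y + ρ` for an ARBITRARY offset `ρ : Site d`, every theorem re-proved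
ρ-generically by node 5's own one-line scripts, the `ρ = 0` instances identified with node 5's declarations BY NAME, and
ONE structural corollary that is new: at LINEAR order re-rooting is a coarse exact form (below).  Node 5's root-free
objects (`segUp/segDown/seg/rev/shift/grad`, `corner/axial`, `straightSum`, `blockTotal`, `blk/off`) are used BY NAME,
never restated.  Nothing of node 5 is deleted or re-proposed ((R32-1): «the landed base-rooted objects are the ρ = 0
instances»).

WHAT IS TYPED (integer coordinates as in node 5; `y ∈ ℤ^d` the coarse index, block `B(y) = L·y + toSite '' box`,
root `r(y) = L·y + ρ`, coarse bond `c = ⟨r(y), r(y) + L·e_μ⟩ = ⟨r(y), r(y + e_μ)⟩`).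
* §1 `gammaCAt ρ A L μ y b` = letters of `Γ_{r(y), x} ∪ [x, x(c)] ∪ (Γ_{r(y+e_μ), x(c)})⁻¹`, `x = L·y + b`,
  `x(c) = x + L·e_μ` — LITERALLY node 5's `gammaC` with root `L·y + ρ` (node 5's `axial A y x` is endpoint-general:
  signed segments); `loopCAt ρ` = `gammaCAt ρ ++ rev (segUp A (L·y + ρ) μ L)` (closed with the straight root-to-root
  coarse bond); telescoping `gammaCAt_sum_grad = f(r(y) + L·e_μ) − f(r(y))` for EVERY `x` (the linearised (11)),
  `loopCAt_sum_grad = 0`; lengths `≤ (2d+1)L − 2d` / `≤ (2d+2)L − 2d` when the root offset lies in the box (`ρ = toSite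
  r`, `r ∈ box`); translation covariance `gammaCAt_add`/`loopCAt_add` (coarse index `y ↦ y + v` ≡ form `shift (L·v)`);
  linearity `gammaCAt_sum_sub`; the bridges `gammaCAt_zero : gammaCAt 0 = gammaC`, `loopCAt_zero`.
* §2 `linAvgAt ρ` (= `Σ_{x∈B(y)} A(Γ^ρ_{c,x})`, unnormalised (14) from the root `r`), `LamAt ρ` (block axial potential
  from the root), node 5's root-free `straightSum` by name; `linAvgAt_eq_straight_sub_grad : linAvgAt ρ A L μ y =
  straightSum A L μ y + (LamAt ρ A L y − LamAt ρ A L (y + e_μ))` («the axial tails are pure gauge», any root);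
  **`linAvgAt_eq_linAvg_add` : `linAvgAt ρ A L μ y = linAvg A L μ y + ((LamAt ρ A L y − Lam A L y) − (LamAt ρ A L (y +
  e_μ) − Lam A L (y + e_μ)))`** — RE-ROOTING CHANGES THE LINEAR AVERAGING ONLY BY THE COARSE GRADIENT OF THE BLOCK
  FUNCTION `LamAt ρ − Lam` (a linearised coarse gauge transformation); `linAvgAt_grad`, `linAvgAt_add`, bridges
  `linAvgAt_zero`/`LamAt_zero`, and over a `CommRing` `linAvgAt_eq_contourSum_sub_dz` (an2's `contourSum`, `dz`).
* §3 GAUGE ((1.9)/(1.10) from the root): `linAvgAt_gauge : linAvgAt ρ (A − grad λ) = linAvgAt ρ A − #B·(λ(r + L·e_μ) −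
  λ(r))`; `AxialGaugeAt ρ A L` (`A(Γ_{r(y),x}) = 0` on every block); `LamAt_eq_zero_of_axialGaugeAt`;
  `linAvgAt_eq_straightSum_of_axialGaugeAt` ((1.8) = (1.11) on rooted-axial fields, ANY root); `axialGaugeAt_rigid`
  (`λ` is block-constant: `λ(L·y + b) = λ(r(y))`); `treeGaugeAt ρ A L x := A(Γ_{r(y(x)), x})` and
  `axialGaugeAt_treeGaugeAt` (attainability) for a root offset INSIDE the box (`ρ = toSite r`, `r ∈ box`, so that the
  root is a point of its own block and `Γ_{r,r} = ∅`); bridges `axialGaugeAt_zero_iff`, `treeGaugeAt_zero`.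
* §4 THE CENTRED OFFSET: `ctrOff L : Fin d → ℕ := fun _ ↦ (L − 1)/2`, `ctr L := toSite (ctrOff L)`; `ctrOff_mem_box`
  (`1 ≤ L`); `two_mul_half_add_one : Odd L → 2·((L−1)/2) + 1 = L` (the centre is equidistant from the two faces — the
  arithmetic behind X-an5-17 (F0); the reflection transport itself is NOT here, see below); `ctr_apply`.
* §5 kernel examples (`decide`) on `ℤ²`, `L = 3`, centre root `(1,1)`: the letters of `Γ^ρ_{c,x}` for `x = (0,2)` (a
  path that first moves UP in `x₂` then DOWN in `x₁` — centre contours run in both directions, unlike node 5's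
  monotone corner contours), and the closed loop.
NOT HERE (announced, journal l.465/l.490): the reflection transport of `gammaCAt (ctr L)` under an5's `R1 α`/`sref`/
`bref` (those are typed over `ℝ` in `Beta.ResolventReflection`; the transport lemma goes to a separate light leaf or to
an5's `RootedComb`, ONE definition either way); node 7a's counts/kernels over `loopCAt ρ` (next leaf of this lineage);
the mixed/third-jet tables; holonomies; anything about minimisers, propagators, B5/B7/B12 claims.  NOT continuum; NOT
Clay.

Provenance: b2b-balaban β sub-cell, unit beta-an1 gen 13 (node 5ρ AVERAGING-CONTOURS-ROOTED), 2026-08-19; over node 5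
`Beta.AveragingContours` v1.1.1 BY NAME.  Bib keys (locators only): Balaban1984PropagatorsI, Balaban1985Averaging,
Balaban1987RG1, Balaban1989LargeFieldII.
-/

namespace Literature.MathematicalPhysics.QuantumFieldTheory.Balaban1983to89.Beta.AveragingContoursRooted

open Finset
open Literature.MathematicalPhysics.QuantumFieldTheory.Balaban1983to89.Beta.AffineAveraging
open Literature.MathematicalPhysics.QuantumFieldTheory.Balaban1983to89.Beta.AveragingContours

/-! ## §1 The rooted block contour `Γ^ρ_{c,x}` and the rooted closed loop -/

section Gamma

variable {d : ℕ} {R : Type*} [AddCommGroup R]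

/-- [folklore] `Γ^ρ_{c,x}` for the coarse bond `c = ⟨r(y), r(y) + L·e_μ⟩`, root `r(y) = L·y + ρ`, and the fine point
`x = L·y + b` of the block `B(y)`: `Γ_{r(y),x} ∪ [x, x(c)] ∪ (Γ_{r(y)+L·e_μ, x(c)})⁻¹`, `x(c) = x + L·e_μ` — node 5's
`gammaC` with the root `L·y` replaced by `L·y + ρ`. -/
def gammaCAt (ρ : Site d) (A : Form1 d R) (L : ℕ) (μ : Fin d) (y : Site d) (b : Fin d → ℕ) : List R :=
  axial A ((L : ℤ) • y + ρ) ((L : ℤ) • y + toSite b)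
    ++ segUp A ((L : ℤ) • y + toSite b) μ L
    ++ rev (axial A ((L : ℤ) • y + ρ + (L : ℤ) • unitVec μ) ((L : ℤ) • y + toSite b + (L : ℤ) • unitVec μ))

/-- [folklore] The rooted closed loop `Γ^ρ_{c,x} ∪ (−c)`: back from `r(y) + L·e_μ` to `r(y)` along the reversed straight
coarse bond (its `L` fine bonds from the root). -/
def loopCAt (ρ : Site d) (A : Form1 d R) (L : ℕ) (μ : Fin d) (y : Site d) (b : Fin d → ℕ) : List R :=
  gammaCAt ρ A L μ y b ++ rev (segUp A ((L : ℤ) • y + ρ) μ L)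

/-- [folklore] BRIDGE: at `ρ = 0` the rooted contour IS node 5's `gammaC`. -/
@[simp] theorem gammaCAt_zero (A : Form1 d R) (L : ℕ) (μ : Fin d) (y : Site d) (b : Fin d → ℕ) :
    gammaCAt 0 A L μ y b = gammaC A L μ y b := by
  simp only [gammaCAt, gammaC, add_zero]

/-- [folklore] BRIDGE: at `ρ = 0` the rooted loop IS node 5's `loopC`. -/
@[simp] theorem loopCAt_zero (A : Form1 d R) (L : ℕ) (μ : Fin d) (y : Site d) (b : Fin d → ℕ) :
    loopCAt 0 A L μ y b = loopC A L μ y b := by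
  simp only [loopCAt, loopC, gammaCAt_zero, add_zero]

/-- [folklore] LINEARISED GAUGE COVARIANCE from the root: for an exact fine form `A = grad f`, `A(Γ^ρ_{c,x}) = f(r(y) +
L·e_μ) − f(r(y))` for EVERY `x ∈ B(y)`. -/
theorem gammaCAt_sum_grad (ρ : Site d) (f : Site d → R) (L : ℕ) (μ : Fin d) (y : Site d) (b : Fin d → ℕ) :
    (gammaCAt ρ (grad f) L μ y b).sum
      = f ((L : ℤ) • y + ρ + (L : ℤ) • unitVec μ) - f ((L : ℤ) • y + ρ) := by
  simp only [gammaCAt, List.sum_append, rev_sum, axial_sum_grad, segUp_sum_grad]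
  abel

/-- [folklore] The rooted closed loop has zero circulation on exact forms. -/
theorem loopCAt_sum_grad (ρ : Site d) (f : Site d → R) (L : ℕ) (μ : Fin d) (y : Site d) (b : Fin d → ℕ) :
    (loopCAt ρ (grad f) L μ y b).sum = 0 := by
  simp only [loopCAt, List.sum_append, rev_sum, gammaCAt_sum_grad, segUp_sum_grad]
  abel

/-- [folklore] On the block, from a root INSIDE the block: `|Γ_{L·y + r, L·y + b}| ≤ d·(L − 1)` for `r, b ∈ {0,…,L−1}^d`. -/
theorem axial_length_root_block (A : Form1 d R) (z : Site d) {L : ℕ} {r b : Fin d → ℕ} (hr : ∀ i, r i < L)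
    (hb : ∀ i, b i < L) : (axial A (z + toSite r) (z + toSite b)).length ≤ d * (L - 1) := by
  rw [axial_length]
  calc ∑ i : Fin d, ((z + toSite b) i - (z + toSite r) i).natAbs ≤ ∑ _i : Fin d, (L - 1) := by
        refine Finset.sum_le_sum fun i _ => ?_
        have h1 := hr i; have h2 := hb i
        simp only [Pi.add_apply, toSite, add_sub_add_left_eq_sub]
        omega
    _ = d * (L - 1) := by simp

/-- [folklore] `|Γ^ρ_{c,x}| ≤ (2d+1)L − 2d` for `x ∈ B(y)` and a root offset inside the box (`ρ = toSite r`, `r ∈ box`;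
cf. B7 p.25, the display after (46)). -/
theorem gammaCAt_length_le (A : Form1 d R) {L : ℕ} (hL : 1 ≤ L) (μ : Fin d) (y : Site d) {r b : Fin d → ℕ}
    (hr : r ∈ box d L) (hb : b ∈ box d L) :
    (gammaCAt (toSite r) A L μ y b).length ≤ (2 * d + 1) * L - 2 * d := by
  have hr' : ∀ i, r i < L := by
    simpa [AffineAveraging.box, Fintype.mem_piFinset, Finset.mem_range] using hr
  have hb' : ∀ i, b i < L := by
    simpa [AffineAveraging.box, Fintype.mem_piFinset, Finset.mem_range] using hb
  have h1 : (axial A ((L : ℤ) • y + toSite r) ((L : ℤ) • y + toSite b)).length ≤ d * (L - 1) :=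
    axial_length_root_block A _ hr' hb'
  have hx : (L : ℤ) • y + toSite b + (L : ℤ) • unitVec μ = ((L : ℤ) • y + (L : ℤ) • unitVec μ) + toSite b := by
    abel
  have hρ : (L : ℤ) • y + toSite r + (L : ℤ) • unitVec μ = ((L : ℤ) • y + (L : ℤ) • unitVec μ) + toSite r := by
    abel
  have h2 : (axial A ((L : ℤ) • y + toSite r + (L : ℤ) • unitVec μ)
      ((L : ℤ) • y + toSite b + (L : ℤ) • unitVec μ)).length ≤ d * (L - 1) := by
    rw [hx, hρ]; exact axial_length_root_block A _ hr' hb'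
  simp only [gammaCAt, List.length_append, segUp_length, rev_length]
  have hd : 2 * d ≤ (2 * d + 1) * L := by nlinarith
  zify [hd, hL] at h1 h2 ⊢
  nlinarith

/-- [folklore] `|Γ^ρ_{c,x} ∪ (−c)| ≤ (2d+2)L − 2d` (root offset inside the box). -/
theorem loopCAt_length_le (A : Form1 d R) {L : ℕ} (hL : 1 ≤ L) (μ : Fin d) (y : Site d) {r b : Fin d → ℕ}
    (hr : r ∈ box d L) (hb : b ∈ box d L) :
    (loopCAt (toSite r) A L μ y b).length ≤ (2 * d + 2) * L - 2 * d := by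
  have h := gammaCAt_length_le A hL μ y hr hb
  simp only [loopCAt, List.length_append, rev_length, segUp_length]
  have hd : 2 * d ≤ (2 * d + 1) * L := by nlinarith
  zify [hd, hL, show 2 * d ≤ (2 * d + 2) * L by nlinarith] at h ⊢
  nlinarith

/-- [folklore] TRANSLATION COVARIANCE of `Γ^ρ_{c,x}`: shifting the coarse index `y ↦ y + v` (root offset fixed) is the
same as reading the translated form `shift (L·v) A`. -/
theorem gammaCAt_add (ρ : Site d) (A : Form1 d R) (L : ℕ) (μ : Fin d) (y v : Site d) (b : Fin d → ℕ) :
    gammaCAt ρ A L μ (y + v) b = gammaCAt ρ (shift ((L : ℤ) • v) A) L μ y b := by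
  have e1 : (L : ℤ) • (y + v) = (L : ℤ) • y + (L : ℤ) • v := smul_add _ _ _
  have e2 : (L : ℤ) • y + (L : ℤ) • v + toSite b = ((L : ℤ) • y + toSite b) + (L : ℤ) • v := by abel
  have e2' : (L : ℤ) • y + (L : ℤ) • v + ρ = ((L : ℤ) • y + ρ) + (L : ℤ) • v := by abel
  have e3 : (L : ℤ) • y + ρ + (L : ℤ) • v + (L : ℤ) • unitVec μ
      = ((L : ℤ) • y + ρ + (L : ℤ) • unitVec μ) + (L : ℤ) • v := by abel
  have e4 : (L : ℤ) • y + toSite b + (L : ℤ) • v + (L : ℤ) • unitVec μ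
      = ((L : ℤ) • y + toSite b + (L : ℤ) • unitVec μ) + (L : ℤ) • v := by abel
  simp only [gammaCAt, e1, e2, e2', e3, e4, axial_add, segUp_add]

/-- [folklore] Translation covariance of the rooted closed loop. -/
theorem loopCAt_add (ρ : Site d) (A : Form1 d R) (L : ℕ) (μ : Fin d) (y v : Site d) (b : Fin d → ℕ) :
    loopCAt ρ A L μ (y + v) b = loopCAt ρ (shift ((L : ℤ) • v) A) L μ y b := by
  have e : (L : ℤ) • y + (L : ℤ) • v + ρ = ((L : ℤ) • y + ρ) + (L : ℤ) • v := by abel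
  simp only [loopCAt, gammaCAt_add, smul_add, e, segUp_add]

/-- [folklore] `A(Γ^ρ_{c,x})` is linear in `A` (differences). -/
theorem gammaCAt_sum_sub (ρ : Site d) (A A' : Form1 d R) (L : ℕ) (μ : Fin d) (y : Site d) (b : Fin d → ℕ) :
    (gammaCAt ρ (A - A') L μ y b).sum = (gammaCAt ρ A L μ y b).sum - (gammaCAt ρ A' L μ y b).sum := by
  simp only [gammaCAt, List.sum_append, rev_sum, axial_sum_sub, segUp_sum_sub]
  abel

/-- [folklore] `A(Γ^ρ_{c,x} ∪ (−c))` is linear in `A` (differences). -/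
theorem loopCAt_sum_sub (ρ : Site d) (A A' : Form1 d R) (L : ℕ) (μ : Fin d) (y : Site d) (b : Fin d → ℕ) :
    (loopCAt ρ (A - A') L μ y b).sum = (loopCAt ρ A L μ y b).sum - (loopCAt ρ A' L μ y b).sum := by
  simp only [loopCAt, List.sum_append, rev_sum, gammaCAt_sum_sub, segUp_sum_sub]
  abel

end Gamma

/-! ## §2 The rooted linear averaging and «re-rooting is a coarse exact form at linear order» -/

section LinAvg

variable {d : ℕ} {R : Type*} [AddCommGroup R]

/-- [folklore] The unnormalised rooted linear averaging: `Σ_{x∈B(y)} A(Γ^ρ_{c,x})`. -/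
def linAvgAt (ρ : Site d) (A : Form1 d R) (L : ℕ) (μ : Fin d) (y : Site d) : R :=
  ∑ b ∈ box d L, (gammaCAt ρ A L μ y b).sum

/-- [folklore] The rooted block axial potential `Λ^ρ(y) = Σ_{x∈B(y)} A(Γ_{r(y), x})`. -/
def LamAt (ρ : Site d) (A : Form1 d R) (L : ℕ) (y : Site d) : R :=
  ∑ b ∈ box d L, (axial A ((L : ℤ) • y + ρ) ((L : ℤ) • y + toSite b)).sum

/-- [folklore] BRIDGE: `linAvgAt 0 = linAvg`. -/
@[simp] theorem linAvgAt_zero (A : Form1 d R) (L : ℕ) (μ : Fin d) (y : Site d) :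
    linAvgAt 0 A L μ y = linAvg A L μ y := by
  simp only [linAvgAt, linAvg, gammaCAt_zero]

/-- [folklore] BRIDGE: `LamAt 0 = Lam`. -/
@[simp] theorem LamAt_zero (A : Form1 d R) (L : ℕ) (y : Site d) : LamAt 0 A L y = Lam A L y := by
  simp only [LamAt, Lam, add_zero]

/-- [folklore] THE AXIAL TAILS ARE PURE GAUGE, ANY ROOT: `linAvgAt ρ = straightSum + (Λ^ρ(y) − Λ^ρ(y + e_μ))` with node
5's root-free straight-contour sum. -/
theorem linAvgAt_eq_straight_sub_grad (ρ : Site d) (A : Form1 d R) (L : ℕ) (μ : Fin d) (y : Site d) :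
    linAvgAt ρ A L μ y = straightSum A L μ y + (LamAt ρ A L y - LamAt ρ A L (y + unitVec μ)) := by
  have hc : (L : ℤ) • y + ρ + (L : ℤ) • unitVec μ = (L : ℤ) • (y + unitVec μ) + ρ := by rw [smul_add]; abel
  have hx : ∀ b : Fin d → ℕ, (L : ℤ) • y + toSite b + (L : ℤ) • unitVec μ = (L : ℤ) • (y + unitVec μ) + toSite b := by
    intro b; rw [smul_add]; abel
  simp only [linAvgAt, straightSum, LamAt, gammaCAt, List.sum_append, rev_sum, hc, hx, Finset.sum_add_distrib,
    Finset.sum_neg_distrib]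
  abel

/-- [folklore] … as an identity of coarse one-forms: `linAvgAt ρ A L = straightSum A L − grad (LamAt ρ A L)`. -/
theorem linAvgAt_eq (ρ : Site d) (A : Form1 d R) (L : ℕ) :
    (fun μ y => linAvgAt ρ A L μ y) = (fun μ y => straightSum A L μ y) - grad (LamAt ρ A L) := by
  funext μ y
  simp only [Pi.sub_apply, grad, linAvgAt_eq_straight_sub_grad]
  abel

/-- [folklore] **RE-ROOTING IS A COARSE EXACT FORM AT LINEAR ORDER:** the rooted and the base-rooted linear
averagings differ by the coarse gradient of the block function `Λ^ρ − Λ` — a linearised gauge transformation of the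
coarse field.  (So every non-covariance of the base-rooted FIRST-order average under a symmetry fixing the centred
system, e.g. an5's X-an5-17 (F2), sits in this exact form.) -/
theorem linAvgAt_eq_linAvg_add (ρ : Site d) (A : Form1 d R) (L : ℕ) (μ : Fin d) (y : Site d) :
    linAvgAt ρ A L μ y = linAvg A L μ y
      + ((LamAt ρ A L y - Lam A L y) - (LamAt ρ A L (y + unitVec μ) - Lam A L (y + unitVec μ))) := by
  rw [linAvgAt_eq_straight_sub_grad, linAvg_eq_straight_sub_grad]
  abel

/-- [folklore] The same between two arbitrary roots. -/
theorem linAvgAt_eq_linAvgAt_add (ρ ρ' : Site d) (A : Form1 d R) (L : ℕ) (μ : Fin d) (y : Site d) :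
    linAvgAt ρ A L μ y = linAvgAt ρ' A L μ y
      + ((LamAt ρ A L y - LamAt ρ' A L y) - (LamAt ρ A L (y + unitVec μ) - LamAt ρ' A L (y + unitVec μ))) := by
  rw [linAvgAt_eq_straight_sub_grad, linAvgAt_eq_straight_sub_grad]
  abel

/-- [folklore] On exact forms: `linAvgAt ρ (grad f) L μ y = #B · (f(r(y) + L·e_μ) − f(r(y)))`. -/
theorem linAvgAt_grad (ρ : Site d) (f : Site d → R) (L : ℕ) (μ : Fin d) (y : Site d) :
    linAvgAt ρ (grad f) L μ y
      = (box d L).card • (f ((L : ℤ) • y + ρ + (L : ℤ) • unitVec μ) - f ((L : ℤ) • y + ρ)) := by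
  simp only [linAvgAt, gammaCAt_sum_grad, Finset.sum_const]

/-- [folklore] Translation covariance of the rooted averaging. -/
theorem linAvgAt_add (ρ : Site d) (A : Form1 d R) (L : ℕ) (μ : Fin d) (y v : Site d) :
    linAvgAt ρ A L μ (y + v) = linAvgAt ρ (shift ((L : ℤ) • v) A) L μ y := by
  simp only [linAvgAt, gammaCAt_add]

/-- [folklore] Translation covariance of the rooted block potential. -/
theorem LamAt_add (ρ : Site d) (A : Form1 d R) (L : ℕ) (y v : Site d) :
    LamAt ρ A L (y + v) = LamAt ρ (shift ((L : ℤ) • v) A) L y := by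
  have e1 : (L : ℤ) • (y + v) = (L : ℤ) • y + (L : ℤ) • v := smul_add _ _ _
  have e2 : ∀ b : Fin d → ℕ, (L : ℤ) • y + (L : ℤ) • v + toSite b = ((L : ℤ) • y + toSite b) + (L : ℤ) • v := by
    intro b; abel
  have e3 : (L : ℤ) • y + (L : ℤ) • v + ρ = ((L : ℤ) • y + ρ) + (L : ℤ) • v := by abel
  simp only [LamAt, e1, e2, e3, axial_add]

/-- [folklore] `A(Γ^ρ)`-sums are linear in `A`: the rooted averaging of a difference. -/
theorem linAvgAt_sub (ρ : Site d) (A A' : Form1 d R) (L : ℕ) (μ : Fin d) (y : Site d) :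
    linAvgAt ρ (A - A') L μ y = linAvgAt ρ A L μ y - linAvgAt ρ A' L μ y := by
  simp only [linAvgAt, gammaCAt_sum_sub, Finset.sum_sub_distrib]

end LinAvg

section Bridge

variable {d : ℕ} {R : Type*} [CommRing R]

/-- [folklore] The rooted (14) = an2's straight-contour sum [Balaban1984PropagatorsI] (1.11) MINUS the coarse exact form
`dz Λ^ρ`. -/
theorem linAvgAt_eq_contourSum_sub_dz (ρ : Site d) (A : Form1 d R) (L : ℕ) (μ : Fin d) (y : Site d) :
    linAvgAt ρ A L μ y = contourSum L A μ y - dz (LamAt ρ A L) μ y := by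
  rw [linAvgAt_eq_straight_sub_grad, straightSum_eq_contourSum, dz]
  abel

end Bridge

/-! ## §3 Gauge covariance and the rooted axial gauge -/

section Gauge

variable {d : ℕ} {R : Type*} [AddCommGroup R]

/-- [folklore] **(1.9) FROM THE ROOT:** under `A ↦ A − grad λ` the rooted averaged field changes by the coarse gradient of
the restriction of `λ` to the ROOT lattice `{L·y + ρ}`, times `#B = L^d`. -/
theorem linAvgAt_gauge (ρ : Site d) (A : Form1 d R) (lam : Site d → R) (L : ℕ) (μ : Fin d) (y : Site d) :
    linAvgAt ρ (A - grad lam) L μ y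
      = linAvgAt ρ A L μ y
        - (box d L).card • (lam ((L : ℤ) • y + ρ + (L : ℤ) • unitVec μ) - lam ((L : ℤ) • y + ρ)) := by
  rw [linAvgAt_sub, linAvgAt_grad]

/-- [folklore] **(1.10) FROM THE ROOT:** the rooted axial gauge `A(Γ_{r(y),x}) = 0` for every block and every `x ∈ B(y)`. -/
def AxialGaugeAt (ρ : Site d) (A : Form1 d R) (L : ℕ) : Prop :=
  ∀ (y : Site d) (b : Fin d → ℕ), b ∈ box d L → (axial A ((L : ℤ) • y + ρ) ((L : ℤ) • y + toSite b)).sum = 0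

/-- [folklore] BRIDGE: `AxialGaugeAt 0 ↔ node 5's AxialGauge`. -/
theorem axialGaugeAt_zero_iff (A : Form1 d R) (L : ℕ) : AxialGaugeAt 0 A L ↔ AxialGauge A L := by
  simp only [AxialGaugeAt, AxialGauge, add_zero]

/-- [folklore] In the rooted axial gauge the rooted block potential vanishes. -/
theorem LamAt_eq_zero_of_axialGaugeAt {ρ : Site d} {A : Form1 d R} {L : ℕ} (hA : AxialGaugeAt ρ A L) (y : Site d) :
    LamAt ρ A L y = 0 :=
  Finset.sum_eq_zero fun b hb => hA y b hb

/-- [folklore] **ON ROOTED-AXIAL-GAUGE FIELDS THE TWO POINTS OF VIEW COINCIDE, ANY ROOT:** `Σ_x A(Γ^ρ_{c,x}) =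
Σ_x A([x, x(c)])`. -/
theorem linAvgAt_eq_straightSum_of_axialGaugeAt {ρ : Site d} {A : Form1 d R} {L : ℕ} (hA : AxialGaugeAt ρ A L)
    (μ : Fin d) (y : Site d) : linAvgAt ρ A L μ y = straightSum A L μ y := by
  rw [linAvgAt_eq_straight_sub_grad, LamAt_eq_zero_of_axialGaugeAt hA, LamAt_eq_zero_of_axialGaugeAt hA, sub_zero,
    add_zero]

/-- [folklore] **RIGIDITY OF THE ROOTED AXIAL GAUGE:** if `A` and `A − grad λ` are both rooted-axial, `λ` is constant on
every block (equal to its value at the root). -/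
theorem axialGaugeAt_rigid {ρ : Site d} {A : Form1 d R} {lam : Site d → R} {L : ℕ} (hA : AxialGaugeAt ρ A L)
    (hA' : AxialGaugeAt ρ (A - grad lam) L) (y : Site d) {b : Fin d → ℕ} (hb : b ∈ box d L) :
    lam ((L : ℤ) • y + toSite b) = lam ((L : ℤ) • y + ρ) := by
  have h := hA' y b hb
  rw [axial_sum_sub, axial_sum_grad, hA y b hb, zero_sub, neg_eq_zero, sub_eq_zero] at h
  exact h

/-- [folklore] THE ROOTED TREE GAUGE: `λ_A(x) = A(Γ_{r(y(x)), x})`, the integral of `A` along the axial contour from the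
ROOT of the block of `x` (node 5's block decomposition `blk`). -/
def treeGaugeAt (ρ : Site d) (A : Form1 d R) (L : ℕ) (x : Site d) : R :=
  (axial A ((L : ℤ) • blk L x + ρ) x).sum

/-- [folklore] BRIDGE: `treeGaugeAt 0 = node 5's treeGauge`. -/
@[simp] theorem treeGaugeAt_zero (A : Form1 d R) (L : ℕ) (x : Site d) : treeGaugeAt 0 A L x = treeGauge A L x := by
  simp only [treeGaugeAt, treeGauge, add_zero]

/-- [folklore] **THE ROOTED AXIAL GAUGE IS ATTAINABLE** when the root lies in its own block (`ρ = toSite r`, `r ∈ box`):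
`A − grad λ_A` is rooted-axial. -/
theorem axialGaugeAt_treeGaugeAt (A : Form1 d R) (L : ℕ) {r : Fin d → ℕ} (hr : r ∈ box d L) :
    AxialGaugeAt (toSite r) (A - grad (treeGaugeAt (toSite r) A L)) L := by
  intro y b hb
  rw [axial_sum_sub, axial_sum_grad, treeGaugeAt, treeGaugeAt, blk_block y hb, blk_block y hr, axial_self,
    List.sum_nil, sub_zero, sub_self]

end Gauge

/-! ## §4 The centred offset `ρ_c = ((L−1)/2)·𝟙` ([Balaban1987RG1] p.251: cubes «with a center at y», `L` odd) -/

section Centre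

variable {d : ℕ}

/-- [folklore] The centred offset as a box element: every coordinate `(L − 1)/2` (natural-number division; for odd `L`
this is the exact centre). -/
def ctrOff (d L : ℕ) : Fin d → ℕ := fun _ => (L - 1) / 2

/-- [folklore] The centred root offset `ρ_c = toSite (ctrOff d L)`. -/
def ctr (d L : ℕ) : Site d := toSite (ctrOff d L)

/-- [folklore] `ρ_c` coordinatewise. -/
@[simp] theorem ctr_apply (L : ℕ) (i : Fin d) : ctr d L i = (((L - 1) / 2 : ℕ) : ℤ) := rfl

/-- [folklore] The centred offset lies in the box as soon as `1 ≤ L` (so `gammaCAt_length_le`,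
`axialGaugeAt_treeGaugeAt` apply to the centred root). -/
theorem ctrOff_mem_box {L : ℕ} (hL : 1 ≤ L) : ctrOff d L ∈ box d L := by
  simp only [AffineAveraging.box, Fintype.mem_piFinset, Finset.mem_range, ctrOff]
  intro _; omega

/-- [folklore] For odd `L` the centre is equidistant from the two faces of `{0,…,L−1}`: `2·((L−1)/2) + 1 = L` (the
arithmetic behind X-an5-17 (F0): the block-compatible axis reflections fix the centred root lattice). -/
theorem two_mul_half_add_one {L : ℕ} (hL : Odd L) : 2 * ((L - 1) / 2) + 1 = L := by
  obtain ⟨m, rfl⟩ := hL; omega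

/-- [folklore] … in the integer form used by reflections `x ↦ (L − 1) − x` of the box: the centre coordinate is fixed. -/
theorem sub_one_sub_ctr {L : ℕ} (hL : Odd L) (i : Fin d) : ((L : ℤ) - 1) - ctr d L i = ctr d L i := by
  have h := two_mul_half_add_one hL
  rw [ctr_apply]
  omega

end Centre

/-! ## §5 Kernel examples (`decide`): centre-rooted contours on `ℤ²`, `L = 3`, root `(1,1)` -/

section Example

/-- [folklore] For `L = 3`, `μ = 0`, `y = 0`, centred root `r = (1,1)` and `x = (0,2)` (`b = (0,2)`): `Γ_{r,x}` first
moves `x₂` UP `(1,1) → (1,2)` then `x₁` DOWN `(1,2) → (0,2)`; then `[x, x + 3e₁]`; then back from `(3,2)` to `r + 3e₁ =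
(4,1)` along `(Γ_{(4,1),(3,2)})⁻¹`: letters (node 5's `label`: bond `⟨x, x+e_κ⟩ ↦ 100κ + 10x₀ + x₁`)
`[A₁(1,1), −A₀(0,2), A₀(0,2), A₀(1,2), A₀(2,2), A₀(3,2), −A₁(4,1)] = [111, −2, 2, 12, 22, 32, −141]`. -/
theorem example_gammaCAt :
    gammaCAt (ctr 2 3) label 3 0 (fun _ => 0) (fun i => if i = 0 then 0 else 2) = [111, -2, 2, 12, 22, 32, -141] := by
  decide

/-- [folklore] … and the centred closed loop appends the reversed root-to-root coarse bond `[−A₀(3,1), −A₀(2,1), −A₀(1,1)]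
= [−31, −21, −11]`. -/
theorem example_loopCAt :
    loopCAt (ctr 2 3) label 3 0 (fun _ => 0) (fun i => if i = 0 then 0 else 2)
      = [111, -2, 2, 12, 22, 32, -141, -31, -21, -11] := by
  decide

/-- [folklore] The same block point from node 5's CORNER root `(0,0)`: a monotone contour, different letters
(`[A₁(0,0), A₁(0,1), A₀(0,2), A₀(1,2), A₀(2,2), −A₁(3,1), −A₁(3,0)]`) — re-rooting changes the letter lists, not only
their base point. -/
theorem example_gammaC_corner :
    gammaC label 3 0 (fun _ => 0) (fun i => if i = 0 then 0 else 2) = [100, 101, 2, 12, 22, -131, -130] := by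
  decide

end Example

end Literature.MathematicalPhysics.QuantumFieldTheory.Balaban1983to89.Beta.AveragingContoursRooted
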